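import Literature.NumberTheory.Automorphic.GlobalWhittakerCoefficient
import Literature.NumberTheory.Automorphic.ShintaniWhittakerFormula
import Literature.NumberTheory.Automorphic.AdicCompletionLocalField
import Literature.NumberTheory.Automorphic.JacquetLanglandsParts
import HarnessLib

/-!
# The global Whittaker coefficient restricted to `GL_n(K_v)` is an unramified Whittaker–Hecke
datum; Shintani's formula for `W_φ` at the unramified places

Topic `NumberTheory/Automorphic`; namespace `Literature.NumberTheory.Automorphic`. A brick of the
decomposition of the named fact `StandardLFunctionData.multipliable_L` of `AutomorphicLFunction`
(Jacquet–Shalika, *On Euler products and the classification of automorphic representations I*,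
Amer. J. Math. **103** (1981), Thm. (5.3)) through the real-point Rankin–Selberg / mean-square
method (`JacquetShalikaSchurSelfSum`: what the global theory must deliver is a bound for the finite
partial products of the unramified torus sums `∑_λ |s_λ(x_v)|² q_v^{-|λ|σ}`). The local input of
that method at a finite place `v ∉ S` is the **Euler factor structure of the global Whittaker
coefficient** `W_φ(g) = ∫_{N_n(K)\N_n(𝔸_K)} φ(u g) ψ̄(u) du` (`whittakerCoeff`,
`GlobalWhittakerCoefficient`) of a spherical Hecke eigenform `φ`:

  `W_φ(ι_v(ϖ_v^μ) g') = q_v^{-b(μ)/2} s_μ(x_v) W_φ(g')`   (`μ` antitone, `g'_v = 1`),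

and `W_φ(ι_v(ϖ_v^ν) g') = 0` for non-antitone `ν` (Jacquet–Shalika (1981), §2 with Shintani (1976);
Cogdell (2004), §3, proof of Thm. 3.3: "`W_v` is the normalised spherical Whittaker function, given
by Shintani's formula"). In print this is obtained from the uniqueness of local Whittaker models and
the factorisation `W_φ = ∏_v W_v` for factorizable `φ`; here it is proved **without multiplicity
one and without the tensor-product theorem**, directly from Shintani's difference equations
(`ShintaniWhittakerFormula`): for fixed `g'` with trivial `v`-component, the function
`g_v ↦ W_φ(ι_v(g_v) g')` on `GL_n(K_v)` is itself an unramified Whittaker–Hecke datum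
(`IsUnramifiedWhittakerDatum`) whose value at `1` is `W_φ(g')`, so Shintani's formula
(`apply_piPowGL_eq_schur_mul`) applies to it verbatim. Everything in this file is **proved**; no
definition is introduced (theorems only; the local character `ψ_v = ψ ∘ ι_v` is
`AddChar.adicComponent` of `GlobalAdditiveCharacter`).

## Main statements

* `whittakerCoeff_mul_right`, `whittakerCoeff_mul_of_forall`, `sum_whittakerCoeff_mul_eq`: right
  translations, right invariance and finite (Hecke) sums pass from `φ` to `W_φ`.
* `whittakerCoeff_unipotent_mul` (**`N_n(𝔸_K)`-equivariance**): `W_φ(u₀ g) = ψ(u₀) W_φ(g)` for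
  `u₀ ∈ N_n(𝔸_K)`, `φ` left `GL_n(K)`-invariant, `ψ` trivial on `K`, `𝓕` a fundamental domain of
  `N_n(K)` and `ν` a *right*-invariant measure (the right translate `𝓕 u₀` is again a fundamental
  domain; Mathlib `IsFundamentalDomain.image_of_equiv`, `setIntegral_eq`).
* `glInt_adicCompletion_eq` (`GL_n(𝒪_v)` of `ReductiveGroupData` = the valued congruence subgroup of
  radius `1` of `GLnAdelicStructure`), `isUniformizingElement_of_valued_eq` (`|ϖ|_v = q⁻¹` gives a
  uniformizing element in the sense of `HeckeTransversalGL`): the two dictionaries between the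
  `ValuativeRel` language of the local files and the `Valued` language of the adelic files.
* `isUnramifiedWhittakerDatum_whittakerCoeff_ofLocal` (**the datum**): if `φ : GL_n(𝔸_K) → ℂ` is
  left `GL_n(K)`-invariant, right `ι_v(GL_n(𝒪_v))`-invariant and satisfies the pointwise Hecke
  equations `∑_{y ∈ K₀ t_r K₀ / K₀} φ(g ι_v(y)) = s^{r(n-r)} e_r(x) φ(g)` (`1 ≤ r ≤ n`, the sum over
  the transversal of `HeckeTransversalGL`), then for every `g'` with `g'_v = 1` the function
  `g_v ↦ W_φ(ι_v(g_v) g')` is an `IsUnramifiedWhittakerDatum` for `ψ_v` with parameters `(s, x)`.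
* `whittakerCoeff_ofLocal_piPowGL_eq`, `whittakerCoeff_ofLocal_piPowGL_eq_zero` (**Shintani's
  formula for `W_φ` at `v`**), for `ψ_v` of conductor `𝒪_v` and `s² = #𝓀_v`.

## References

* H. Jacquet, J. A. Shalika, *On Euler products and the classification of automorphic
  representations I*, Amer. J. Math. 103 (1981), 499–558, §2 [JacquetShalikaAJM1981].
* T. Shintani, *On an explicit formula for class-1 "Whittaker functions" on `GL_n` over `P`-adic
  fields*, Proc. Japan Acad. 52 (1976), 180–182 [Shintani1976].
* J. W. Cogdell, *Analytic theory of L-functions for GL_n*, in: J. Bernstein, S. Gelbart (eds.),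
  *An Introduction to the Langlands Program*, Birkhäuser (2004), §1.1, §3 (Thm. 3.3)
  [CogdellAnalyticTheory2004].
-/

noncomputable section

open scoped MatrixGroups ComplexConjugate
open NumberField IsDedekindDomain MeasureTheory Matrix

namespace Literature.NumberTheory.Automorphic

/-! ### Right translations, finite sums and `N_n(𝔸_K)`-equivariance of the Whittaker coefficient -/

section Equivariance

variable {n : ℕ} {K : Type} [Field K] [NumberField K]
variable [MeasurableSpace ↥(adelicUnipotent n K)]
variable (ν : Measure ↥(adelicUnipotent n K)) (𝓕 : Set ↥(adelicUnipotent n K))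
  (ψ : AddChar (AdeleRing (𝓞 K) K) Circle)

/-- `W_φ(g h) = W_{r(h) φ}(g)`: the Whittaker coefficient at a right translate is the coefficient
of the right translated function (Cogdell (2004), §1.1). [folklore] -/
theorem whittakerCoeff_mul_right (φ : GL (Fin n) (AdeleRing (𝓞 K) K) → ℂ)
    (g h : GL (Fin n) (AdeleRing (𝓞 K) K)) :
    whittakerCoeff ν 𝓕 ψ φ (g * h) = whittakerCoeff ν 𝓕 ψ (fun x => φ (x * h)) g := by
  simp only [whittakerCoeff, mul_assoc]

/-- Right invariance passes to the Whittaker coefficient: if `φ(x k) = φ(x)` for all `x`, then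
`W_φ(g k) = W_φ(g)`. [folklore] -/
theorem whittakerCoeff_mul_of_forall {φ : GL (Fin n) (AdeleRing (𝓞 K) K) → ℂ}
    {k : GL (Fin n) (AdeleRing (𝓞 K) K)} (hk : ∀ x, φ (x * k) = φ x)
    (g : GL (Fin n) (AdeleRing (𝓞 K) K)) :
    whittakerCoeff ν 𝓕 ψ φ (g * k) = whittakerCoeff ν 𝓕 ψ φ g := by
  have h : (fun x => φ (x * k)) = φ := funext hk
  rw [whittakerCoeff_mul_right, h]

/-- **Finite (Hecke) sums pass to the Whittaker coefficient.** If
`∑_{i ∈ s} φ(x y_i) = c φ(x)` for all `x` (a pointwise Hecke eigenvalue equation) and the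
integrands are integrable on `𝓕`, then `∑_{i ∈ s} W_φ(g y_i) = c W_φ(g)`. [folklore] -/
theorem sum_whittakerCoeff_mul_eq {φ : GL (Fin n) (AdeleRing (𝓞 K) K) → ℂ} {ι : Type*}
    (s : Finset ι) (y : ι → GL (Fin n) (AdeleRing (𝓞 K) K)) {c : ℂ}
    (hφ : ∀ x, ∑ i ∈ s, φ (x * y i) = c * φ x) (g : GL (Fin n) (AdeleRing (𝓞 K) K))
    (hint : ∀ i ∈ s, IntegrableOn (fun u : ↥(adelicUnipotent n K) =>
      φ ((u : GL (Fin n) (AdeleRing (𝓞 K) K)) * (g * y i)) * conj (whittakerCharFun ψ u)) 𝓕 ν) :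
    ∑ i ∈ s, whittakerCoeff ν 𝓕 ψ φ (g * y i) = c * whittakerCoeff ν 𝓕 ψ φ g := by
  simp only [whittakerCoeff]
  rw [← Finset.smul_sum, ← integral_finsetSum s hint]
  have hpt : ∀ u : ↥(adelicUnipotent n K),
      ∑ i ∈ s, φ ((u : GL (Fin n) (AdeleRing (𝓞 K) K)) * (g * y i)) * conj (whittakerCharFun ψ u) =
        c * (φ ((u : GL (Fin n) (AdeleRing (𝓞 K) K)) * g) * conj (whittakerCharFun ψ u)) := by
    intro u
    rw [← Finset.sum_mul]
    simp_rw [← mul_assoc]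
    rw [hφ, mul_assoc]
  simp_rw [hpt]
  rw [integral_const_mul, mul_smul_comm]

variable {ν 𝓕 ψ}

/-- **`N_n(𝔸_K)`-equivariance of the Whittaker coefficient**: for `φ` left `GL_n(K)`-invariant,
`ψ` a global additive character (trivial on `K`), `𝓕` a measurable fundamental domain of
`N_n(K)` in `N_n(𝔸_K)` and `ν` right invariant, `W_φ(u₀ g) = ψ(u₀) W_φ(g)` for every
`u₀ ∈ N_n(𝔸_K)`: the substitution `u ↦ u u₀` carries `𝓕` to the fundamental domain `𝓕 u₀`, over
which the `N_n(K)`-invariant integrand has the same integral (Cogdell (2004), §1.1: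
"`W_φ(n g) = ψ(n) W_φ(g)`"). [cite: CogdellAnalyticTheory2004, §1.1] -/
theorem whittakerCoeff_unipotent_mul [MeasurableMul ↥(adelicUnipotent n K)]
    [Countable ↥(rationalUnipotent n K)]
    [MeasurableConstSMul ↥(rationalUnipotent n K) ↥(adelicUnipotent n K)]
    [SMulInvariantMeasure ↥(rationalUnipotent n K) ↥(adelicUnipotent n K) ν]
    [ν.IsMulRightInvariant]
    (h𝓕 : IsFundamentalDomain ↥(rationalUnipotent n K) 𝓕 ν) (hψ : IsGlobalAddChar K ψ)
    {φ : GL (Fin n) (AdeleRing (𝓞 K) K) → ℂ} (hφ : IsLeftInvariant (AdelicGroupData.gl n K) φ)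
    (u₀ : ↥(adelicUnipotent n K)) (g : GL (Fin n) (AdeleRing (𝓞 K) K)) :
    whittakerCoeff ν 𝓕 ψ φ ((u₀ : GL (Fin n) (AdeleRing (𝓞 K) K)) * g) =
      whittakerCharFun ψ u₀ * whittakerCoeff ν 𝓕 ψ φ g := by
  -- the `N_n(K)`-invariant integrand of `W_φ(g)`
  set F : ↥(adelicUnipotent n K) → ℂ := fun u =>
    φ ((u : GL (Fin n) (AdeleRing (𝓞 K) K)) * g) * conj (whittakerCharFun ψ u) with hF
  have hFinv : ∀ (γ : ↥(rationalUnipotent n K)) (u : ↥(adelicUnipotent n K)), F (γ • u) = F u :=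
    fun γ u => whittakerIntegrand_smul hψ hφ g γ u
  -- `ψ(u₀) conj ψ(u₀) = 1`
  have hunit : whittakerCharFun ψ u₀ * conj (whittakerCharFun ψ u₀) = 1 := by
    rw [whittakerCharFun_apply, Complex.mul_conj, Complex.normSq_eq_norm_sq, Circle.norm_coe]
    norm_num
  -- the integrand of `W_φ(u₀ g)` at `u` is `ψ(u₀) F(u u₀)`
  have hpt : ∀ u : ↥(adelicUnipotent n K),
      φ ((u : GL (Fin n) (AdeleRing (𝓞 K) K)) * ((u₀ : GL (Fin n) (AdeleRing (𝓞 K) K)) * g)) *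
          conj (whittakerCharFun ψ u) = whittakerCharFun ψ u₀ * F (u * u₀) := by
    intro u
    simp only [hF, Subgroup.coe_mul, mul_assoc, whittakerCharFun_mul, map_mul]
    calc φ (↑u * (↑u₀ * g)) * conj (whittakerCharFun ψ u)
          = φ (↑u * (↑u₀ * g)) * conj (whittakerCharFun ψ u) *
            (whittakerCharFun ψ u₀ * conj (whittakerCharFun ψ u₀)) := by rw [hunit, mul_one]
      _ = whittakerCharFun ψ u₀ * (φ (↑u * (↑u₀ * g)) *
            (conj (whittakerCharFun ψ u) * conj (whittakerCharFun ψ u₀))) := by ring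
  -- right translation by `u₀` preserves `ν` and carries `𝓕` to a fundamental domain
  have hmp : MeasurePreserving (fun u : ↥(adelicUnipotent n K) => u * u₀) ν ν :=
    measurePreserving_mul_right ν u₀
  have hemb : MeasurableEmbedding fun u : ↥(adelicUnipotent n K) => u * u₀ :=
    measurableEmbedding_mulRight u₀
  have hq : Measure.QuasiMeasurePreserving (Equiv.mulRight u₀).symm ν ν :=
    (measurePreserving_mul_right ν u₀⁻¹).quasiMeasurePreserving
  have h𝓕' : IsFundamentalDomain ↥(rationalUnipotent n K)
      ((fun u : ↥(adelicUnipotent n K) => u * u₀) '' 𝓕) ν := by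
    have := h𝓕.image_of_equiv (Equiv.mulRight u₀) hq (Equiv.refl _) fun γ u => ?_
    · simpa only [Equiv.coe_mulRight] using this
    · show (γ • u) * u₀ = γ • (u * u₀)
      exact mul_assoc _ _ _
  calc whittakerCoeff ν 𝓕 ψ φ ((u₀ : GL (Fin n) (AdeleRing (𝓞 K) K)) * g)
        = ((ν 𝓕).toReal⁻¹ : ℝ) • ∫ u in 𝓕, whittakerCharFun ψ u₀ * F (u * u₀) ∂ν := by
        simp only [whittakerCoeff, hpt]
    _ = ((ν 𝓕).toReal⁻¹ : ℝ) • (whittakerCharFun ψ u₀ *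
          ∫ u in (fun u : ↥(adelicUnipotent n K) => u * u₀) '' 𝓕, F u ∂ν) := by
        rw [integral_const_mul, hmp.setIntegral_image_emb hemb]
    _ = ((ν 𝓕).toReal⁻¹ : ℝ) • (whittakerCharFun ψ u₀ * ∫ u in 𝓕, F u ∂ν) := by
        rw [h𝓕'.setIntegral_eq h𝓕 hFinv]
    _ = whittakerCharFun ψ u₀ * whittakerCoeff ν 𝓕 ψ φ g := by
        rw [whittakerCoeff, mul_smul_comm]

end Equivariance

/-! ### The two dictionaries `ValuativeRel` ↔ `Valued` for `K_v` -/

section Dictionary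

open ValuativeRel

variable {n : ℕ} (K : Type) [Field K] [NumberField K] (v : HeightOneSpectrum (𝓞 K))

/-- Membership in the valuation ring `𝒪[K_v]` of the `ValuativeRel` structure of `K_v`
(`AdicCompletionLocalField`) is `|x|_v ≤ 1` for Mathlib's `Valued.v` (the two valuations are
equivalent, `ValuativeRel.isEquiv`). [folklore] -/
theorem mem_integer_adicCompletion_iff {x : v.adicCompletion K} :
    x ∈ 𝒪[v.adicCompletion K] ↔ Valued.v x ≤ 1 := by
  rw [Valuation.mem_integer_iff]
  exact (ValuativeRel.isEquiv (valuation (v.adicCompletion K))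
    (Valued.v : Valuation (v.adicCompletion K) _)).le_one_iff_le_one

/-- `valuation K_v x < 1 ↔ |x|_v < 1`. [folklore] -/
theorem valuation_adicCompletion_lt_one_iff {x : v.adicCompletion K} :
    valuation (v.adicCompletion K) x < 1 ↔ Valued.v x < 1 :=
  (ValuativeRel.isEquiv (valuation (v.adicCompletion K))
    (Valued.v : Valuation (v.adicCompletion K) _)).lt_one_iff_lt_one

/-- **`GL_n(𝒪_v)` in the two languages.** The hyperspecial subgroup `glInt n K_v` of
`ReductiveGroupData` (entries of `g` and `g⁻¹` in the valuation ring of the valuative relation)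
is the valued congruence subgroup of radius `1` of `GLnAdelicStructure` (entries of `g`, `g⁻¹`
of `Valued.v`-valuation `≤ 1`; the third condition `|g - 1| ≤ 1` is then automatic). This is the
identification asked for in the module docstring of `GLnAdelicStructure`. [folklore] -/
theorem glInt_adicCompletion_eq :
    glInt n (v.adicCompletion K) =
      valuedCongruenceSubgroup (Fin n) (1 : WithZero (Multiplicative ℤ)) := by
  ext g
  rw [mem_glInt_iff, mem_valuedCongruenceSubgroup_iff]
  simp only [mem_integer_adicCompletion_iff]
  constructor
  · rintro ⟨h1, h2⟩
    refine ⟨h1, h2, fun i j => ?_⟩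
    rw [Matrix.sub_apply]
    refine (Valuation.map_sub _ _ _).trans (max_le (h1 i j) ?_)
    by_cases hij : i = j
    · subst hij
      rw [Matrix.one_apply_eq, map_one]
    · rw [Matrix.one_apply_ne hij, map_zero]
      exact zero_le
  · rintro ⟨h1, h2, -⟩
    exact ⟨h1, h2⟩

/-- **A uniformizer of `K_v` in the adelic normalisation is a uniformizing element.** If
`|ϖ|_v = exp (-1)` (the normalisation of `HasSatakeParameterAt`), then `ϖ` is non-zero, lies in
`𝒪[K_v]` and generates its maximal ideal (`IsUniformizingElement` of `HeckeTransversalGL`): an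
integer of valuation `< 1` has `|y|_v ≤ exp (-1) = |ϖ|_v`, so `y = ϖ (ϖ⁻¹ y)` with `ϖ⁻¹ y`
integral. [folklore] -/
theorem isUniformizingElement_of_valued_eq {ϖ : v.adicCompletion K}
    (hϖ : Valued.v ϖ = WithZero.exp (-1 : ℤ)) : IsUniformizingElement ϖ := by
  have hlt : Valued.v ϖ < 1 := by
    rw [hϖ, ← WithZero.exp_zero, WithZero.exp_lt_exp]
    norm_num
  have hϖ0 : ϖ ≠ 0 := by
    intro h
    rw [h, map_zero] at hϖ
    exact WithZero.exp_ne_zero hϖ.symm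
  have hvϖ0 : Valued.v ϖ ≠ 0 := by rwa [ne_eq, map_eq_zero]
  have hmem : ϖ ∈ 𝒪[v.adicCompletion K] := (mem_integer_adicCompletion_iff K v).2 hlt.le
  refine ⟨hmem, hϖ0, le_antisymm (fun y hy => ?_) ?_⟩
  · rw [IsLocalRing.mem_maximalIdeal, mem_nonunits_iff,
      (Valuation.integer.integers (valuation (v.adicCompletion K))).isUnit_iff_valuation_eq_one]
      at hy
    have hy1 : valuation (v.adicCompletion K) (y : v.adicCompletion K) < 1 :=
      lt_of_le_of_ne ((Valuation.mem_integer_iff _ _).1 y.2) hy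
    have hy2 : Valued.v (y : v.adicCompletion K) ≤ Valued.v ϖ := by
      rw [hϖ, ← WithZero.lt_mul_exp_iff_le WithZero.exp_ne_zero, ← WithZero.exp_add,
        neg_add_cancel, WithZero.exp_zero]
      exact (valuation_adicCompletion_lt_one_iff K v).1 hy1
    have hz : ϖ⁻¹ * (y : v.adicCompletion K) ∈ 𝒪[v.adicCompletion K] := by
      rw [mem_integer_adicCompletion_iff, map_mul, map_inv₀]
      calc (Valued.v ϖ)⁻¹ * Valued.v (y : v.adicCompletion K)
            ≤ (Valued.v ϖ)⁻¹ * Valued.v ϖ := mul_le_mul_right hy2 _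
        _ = 1 := inv_mul_cancel₀ hvϖ0
    rw [Ideal.mem_span_singleton']
    refine ⟨⟨_, hz⟩, Subtype.ext ?_⟩
    show ϖ⁻¹ * (y : v.adicCompletion K) * ϖ = y
    rw [mul_comm, ← mul_assoc, mul_inv_cancel₀ hϖ0, one_mul]
  · rw [Ideal.span_le, Set.singleton_subset_iff, SetLike.mem_coe, IsLocalRing.mem_maximalIdeal,
      mem_nonunits_iff,
      (Valuation.integer.integers (valuation (v.adicCompletion K))).isUnit_iff_valuation_eq_one]
    exact ((valuation_adicCompletion_lt_one_iff K v).2 hlt).ne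

end Dictionary

/-! ### The local character and the local unipotent elements -/

section Local

open ValuativeRel

variable {n : ℕ} (K : Type) [Field K] [NumberField K] (v : HeightOneSpectrum (𝓞 K))

variable {K v} in
/-- `ι_v` maps `U_n(K_v)` into `U_n(𝔸_K)` (entries of `ι_v(g)` are `δ_{ij} + ι_v(g_{ij} - δ_{ij})`,
`GLn.coe_ofLocal_apply`). [folklore] -/
theorem ofLocal_mem_adelicUnipotent {u : GL (Fin n) (v.adicCompletion K)}
    (hu : u ∈ upperUnitriangular (Fin n) (v.adicCompletion K)) :
    GLn.ofLocal n K v u ∈ adelicUnipotent n K := by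
  rw [mem_upperUnitriangular_iff] at hu
  rw [mem_upperUnitriangular_iff]
  refine ⟨fun i j hij => ?_, fun i => ?_⟩
  · have hne : i ≠ j := fun h => (lt_irrefl _) (h ▸ hij)
    rw [GLn.coe_ofLocal_apply, hu.1 hij, Matrix.one_apply_ne hne, Matrix.one_apply_ne hne, sub_zero,
      map_zero, add_zero]
  · rw [GLn.coe_ofLocal_apply, hu.2 i, Matrix.one_apply_eq, Matrix.one_apply_eq, sub_self, map_zero,
      add_zero]

variable {K v} in
/-- The super-diagonal sum of `ι_v(u) ∈ U_n(𝔸_K)` is `ι_v` of the super-diagonal sum of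
`u ∈ U_n(K_v)`. [folklore] -/
theorem superdiagSum_ofLocal (u : ↥(upperUnitriangular (Fin n) (v.adicCompletion K))) :
    superdiagSum (⟨GLn.ofLocal n K v u, ofLocal_mem_adelicUnipotent u.2⟩ : ↥(adelicUnipotent n K)) =
      adeleSingleHom K v (superdiagSum u) := by
  rw [superdiagSum_def, superdiagSum_def, map_sum]
  refine Finset.sum_congr rfl fun i _ => ?_
  rw [map_sum]
  refine Finset.sum_congr rfl fun j _ => ?_
  split_ifs with h
  · have hij : i ≠ j := by
      intro e
      subst e
      omega
    show (GLn.ofLocal n K v (u : GL (Fin n) (v.adicCompletion K)) :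
        Matrix (Fin n) (Fin n) (AdeleRing (𝓞 K) K)) i j = _
    rw [GLn.coe_ofLocal_apply, Matrix.one_apply_ne hij, Matrix.one_apply_ne hij, zero_add, sub_zero]
  · rw [map_zero]

variable {K v} in
/-- **The generic characters match**: `ψ_U(ι_v(u)) = (ψ_v)_U(u)` for `u ∈ U_n(K_v)`, `ψ_v` the local
component `AddChar.adicComponent`. [folklore] -/
theorem whittakerCharFun_ofLocal (ψ : AddChar (AdeleRing (𝓞 K) K) Circle)
    (u : ↥(upperUnitriangular (Fin n) (v.adicCompletion K))) :
    whittakerCharFun ψ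
        (⟨GLn.ofLocal n K v u, ofLocal_mem_adelicUnipotent u.2⟩ : ↥(adelicUnipotent n K)) =
      whittakerCharFun (ψ.adicComponent v) u := by
  rw [whittakerCharFun_apply, whittakerCharFun_apply, superdiagSum_ofLocal,
    AddChar.adicComponent_apply]

end Local

/-! ### The datum `g_v ↦ W_φ(ι_v(g_v) g')` and Shintani's formula for `W_φ` -/

section Datum

open ValuativeRel Literature.RingTheory.SymmetricFunctions.SymmPoly

variable {n : ℕ} {K : Type} [Field K] [NumberField K] {v : HeightOneSpectrum (𝓞 K)}
variable [MeasurableSpace ↥(adelicUnipotent n K)] [MeasurableMul ↥(adelicUnipotent n K)]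
  [Countable ↥(rationalUnipotent n K)]
  [MeasurableConstSMul ↥(rationalUnipotent n K) ↥(adelicUnipotent n K)]
  {ν : Measure ↥(adelicUnipotent n K)}
  [SMulInvariantMeasure ↥(rationalUnipotent n K) ↥(adelicUnipotent n K) ν] [ν.IsMulRightInvariant]
  {𝓕 : Set ↥(adelicUnipotent n K)} {ψ : AddChar (AdeleRing (𝓞 K) K) Circle}
  {φ : GL (Fin n) (AdeleRing (𝓞 K) K) → ℂ} {ϖ : v.adicCompletion K} {s : ℂ} {x : Fin n → ℂ}
  {g' : GL (Fin n) (AdeleRing (𝓞 K) K)}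

/-- **The global Whittaker coefficient along `GL_n(K_v)` is an unramified Whittaker–Hecke datum.**
Let `φ : GL_n(𝔸_K) → ℂ` be left `GL_n(K)`-invariant, right invariant under `ι_v(GL_n(𝒪_v))`, and
satisfy the pointwise Hecke equations
`∑_{y ∈ K₀ t_r K₀ / K₀} φ(g ι_v(y)) = s^{r(n-r)} e_r(x) φ(g)` for `1 ≤ r ≤ n` (sum over the
transversal `{u_a ϖ^{ε_S}}` of `HeckeTransversalGL`); let `ψ` be a global additive character, `𝓕`
a fundamental domain of `N_n(K)` in `N_n(𝔸_K)` for a right-invariant measure `ν`, the integrands of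
`W_φ` integrable on `𝓕`, and `g' ∈ GL_n(𝔸_K)` with trivial `v`-component. Then
`g_v ↦ W_φ(ι_v(g_v) g')` is an unramified Whittaker–Hecke datum for `ψ_v` with parameters
`(s, x)` (`IsUnramifiedWhittakerDatum`): equivariance by `whittakerCoeff_unipotent_mul` and
`whittakerCharFun_ofLocal`; sphericity and the Hecke sums because `g'` commutes with
`ι_v(GL_n(K_v))` (`GLn.ofLocal_mul_eq_mul_ofLocal_of_toLocal_eq_one`) and right translations and
finite sums pass to `W_φ`. This replaces, for the unramified computation of Jacquet–Shalika (1981),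
§2, the factorisation `W_φ = ∏ W_v` of print (Cogdell (2004), §3). [folklore] -/
theorem isUnramifiedWhittakerDatum_whittakerCoeff_ofLocal
    (h𝓕 : IsFundamentalDomain ↥(rationalUnipotent n K) 𝓕 ν) (hψ : IsGlobalAddChar K ψ)
    (hφ : IsLeftInvariant (AdelicGroupData.gl n K) φ)
    (hφK : ∀ k ∈ glInt n (v.adicCompletion K), ∀ y, φ (y * GLn.ofLocal n K v k) = φ y)
    (hϖ : IsUniformizingElement ϖ)
    (hφT : ∀ r, 1 ≤ r → r ≤ n → ∀ y : GL (Fin n) (AdeleRing (𝓞 K) K),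
      ∑ p : TransversalIndex n (v.adicCompletion K) r,
          φ (y * GLn.ofLocal n K v (p.rep hϖ.ne_zero)) = s ^ (r * (n - r)) * esymm x r * φ y)
    (hint : ∀ g, IntegrableOn (fun u : ↥(adelicUnipotent n K) =>
      φ ((u : GL (Fin n) (AdeleRing (𝓞 K) K)) * g) * conj (whittakerCharFun ψ u)) 𝓕 ν)
    (hg' : Matrix.GeneralLinearGroup.map (AdelicGroupData.adeleEval K v) g' = 1) :
    IsUnramifiedWhittakerDatum hϖ (ψ.adicComponent v)
      (fun y => whittakerCoeff ν 𝓕 ψ φ (GLn.ofLocal n K v y * g')) s x where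
  equivariant u y := by
    show whittakerCoeff ν 𝓕 ψ φ (GLn.ofLocal n K v ((u : GL (Fin n) (v.adicCompletion K)) * y) * g') =
      _ * whittakerCoeff ν 𝓕 ψ φ (GLn.ofLocal n K v y * g')
    rw [map_mul, mul_assoc,
      show GLn.ofLocal n K v (u : GL (Fin n) (v.adicCompletion K)) =
        ((⟨GLn.ofLocal n K v u, ofLocal_mem_adelicUnipotent u.2⟩ : ↥(adelicUnipotent n K)) :
          GL (Fin n) (AdeleRing (𝓞 K) K)) from rfl,
      whittakerCoeff_unipotent_mul h𝓕 hψ hφ, whittakerCharFun_ofLocal]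
  spherical k hk y := by
    show whittakerCoeff ν 𝓕 ψ φ (GLn.ofLocal n K v (y * k) * g') =
      whittakerCoeff ν 𝓕 ψ φ (GLn.ofLocal n K v y * g')
    rw [map_mul, mul_assoc, GLn.ofLocal_mul_eq_mul_ofLocal_of_toLocal_eq_one k hg', ← mul_assoc,
      whittakerCoeff_mul_of_forall ν 𝓕 ψ (hφK k hk)]
  hecke r hr1 hrn y := by
    show ∑ p : TransversalIndex n (v.adicCompletion K) r,
        whittakerCoeff ν 𝓕 ψ φ (GLn.ofLocal n K v (y * p.rep hϖ.ne_zero) * g') =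
      s ^ (r * (n - r)) * esymm x r * whittakerCoeff ν 𝓕 ψ φ (GLn.ofLocal n K v y * g')
    have hterm : ∀ p : TransversalIndex n (v.adicCompletion K) r,
        GLn.ofLocal n K v (y * p.rep hϖ.ne_zero) * g' =
          GLn.ofLocal n K v y * g' * GLn.ofLocal n K v (p.rep hϖ.ne_zero) := fun p => by
      rw [map_mul, mul_assoc, GLn.ofLocal_mul_eq_mul_ofLocal_of_toLocal_eq_one _ hg', ← mul_assoc]
    simp_rw [hterm]
    exact sum_whittakerCoeff_mul_eq ν 𝓕 ψ Finset.univ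
      (fun p : TransversalIndex n (v.adicCompletion K) r => GLn.ofLocal n K v (p.rep hϖ.ne_zero))
      (hφT r hr1 hrn) _ fun p _ => hint _

/-- **Shintani's formula for the global Whittaker coefficient at an unramified place.** In the
situation of `isUnramifiedWhittakerDatum_whittakerCoeff_ofLocal`, if moreover `ψ_v` has conductor
`𝒪_v` (trivial on `𝒪_v`, not on `ϖ⁻¹ 𝒪_v`), `s ≠ 0` and `s² = #𝓀_v`, then for antitone `μ ∈ ℕⁿ`
`W_φ(ι_v(ϖ^μ) g') = s^{-b(μ)} s_μ(x) W_φ(g')`, `b(μ) = ∑_i μ_i (n + 1 - 2i)` (`torusExponent`),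
`s_μ` the Schur polynomial: Jacquet–Shalika (1981), §2 / Cogdell (2004), Thm. 3.3 ("`W_v` is given
by Shintani's formula"), here without the uniqueness of Whittaker models.
[cite: Shintani1976, Theorem (p. 181)] -/
theorem whittakerCoeff_ofLocal_piPowGL_eq
    (h𝓕 : IsFundamentalDomain ↥(rationalUnipotent n K) 𝓕 ν) (hψ : IsGlobalAddChar K ψ)
    (hφ : IsLeftInvariant (AdelicGroupData.gl n K) φ)
    (hφK : ∀ k ∈ glInt n (v.adicCompletion K), ∀ y, φ (y * GLn.ofLocal n K v k) = φ y)
    (hϖ : IsUniformizingElement ϖ)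
    (hφT : ∀ r, 1 ≤ r → r ≤ n → ∀ y : GL (Fin n) (AdeleRing (𝓞 K) K),
      ∑ p : TransversalIndex n (v.adicCompletion K) r,
          φ (y * GLn.ofLocal n K v (p.rep hϖ.ne_zero)) = s ^ (r * (n - r)) * esymm x r * φ y)
    (hint : ∀ g, IntegrableOn (fun u : ↥(adelicUnipotent n K) =>
      φ ((u : GL (Fin n) (AdeleRing (𝓞 K) K)) * g) * conj (whittakerCharFun ψ u)) 𝓕 ν)
    (hg' : Matrix.GeneralLinearGroup.map (AdelicGroupData.adeleEval K v) g' = 1)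
    (hψv : ∀ c ∈ 𝒪[v.adicCompletion K], ψ.adicComponent v c = 1)
    (hψv' : ∃ c ∈ 𝒪[v.adicCompletion K], ψ.adicComponent v (ϖ⁻¹ * c) ≠ 1) (hs : s ≠ 0)
    (hq : ((Nat.card 𝓀[v.adicCompletion K] : ℕ) : ℂ) = s ^ 2) {mu : Fin n → ℕ}
    (hmu : Antitone mu) :
    whittakerCoeff ν 𝓕 ψ φ (GLn.ofLocal n K v (piPowGL hϖ.ne_zero mu) * g') =
      s ^ (-torusExponent mu) * schur x mu * whittakerCoeff ν 𝓕 ψ φ g' := by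
  have h := apply_piPowGL_eq_schur_mul hψv hψv'
    (isUnramifiedWhittakerDatum_whittakerCoeff_ofLocal h𝓕 hψ hφ hφK hϖ hφT hint hg') hs hq hmu
  simpa only [map_one, one_mul] using h

/-- **Vanishing off the antitone cone**: in the situation of
`isUnramifiedWhittakerDatum_whittakerCoeff_ofLocal` with `ψ_v` non-trivial on `ϖ⁻¹ 𝒪_v`,
`W_φ(ι_v(ϖ^ν) g') = 0` for every non-antitone `ν ∈ ℕⁿ` (`apply_piPowGL_eq_zero_of_not_antitone`).
[cite: Shintani1976, Theorem (p. 181)] -/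
theorem whittakerCoeff_ofLocal_piPowGL_eq_zero
    (h𝓕 : IsFundamentalDomain ↥(rationalUnipotent n K) 𝓕 ν) (hψ : IsGlobalAddChar K ψ)
    (hφ : IsLeftInvariant (AdelicGroupData.gl n K) φ)
    (hφK : ∀ k ∈ glInt n (v.adicCompletion K), ∀ y, φ (y * GLn.ofLocal n K v k) = φ y)
    (hϖ : IsUniformizingElement ϖ)
    (hφT : ∀ r, 1 ≤ r → r ≤ n → ∀ y : GL (Fin n) (AdeleRing (𝓞 K) K),
      ∑ p : TransversalIndex n (v.adicCompletion K) r,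
          φ (y * GLn.ofLocal n K v (p.rep hϖ.ne_zero)) = s ^ (r * (n - r)) * esymm x r * φ y)
    (hint : ∀ g, IntegrableOn (fun u : ↥(adelicUnipotent n K) =>
      φ ((u : GL (Fin n) (AdeleRing (𝓞 K) K)) * g) * conj (whittakerCharFun ψ u)) 𝓕 ν)
    (hg' : Matrix.GeneralLinearGroup.map (AdelicGroupData.adeleEval K v) g' = 1)
    (hψv' : ∃ c ∈ 𝒪[v.adicCompletion K], ψ.adicComponent v (ϖ⁻¹ * c) ≠ 1) {nu : Fin n → ℕ}
    (hnu : ¬ Antitone nu) :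
    whittakerCoeff ν 𝓕 ψ φ (GLn.ofLocal n K v (piPowGL hϖ.ne_zero nu) * g') = 0 := by
  have h := isUnramifiedWhittakerDatum_whittakerCoeff_ofLocal h𝓕 hψ hφ hφK hϖ hφT hint hg'
  exact apply_piPowGL_eq_zero_of_not_antitone
    (W := fun y => whittakerCoeff ν 𝓕 ψ φ (GLn.ofLocal n K v y * g')) hϖ hψv' h.equivariant
    h.spherical hnu

end Datum

end Literature.NumberTheory.Automorphic
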